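import Literature.Computability.AlgebraicComplexity.ABV17SingPermFourBlock
import HarnessLib

/-!
# Alper–Bogart–Velasco 2017, §1: `codim Sing(perm_4) ≥ 7` — two further chains at the standard pivot

Third file of the series (framing: `ABV17SingPermFourPrelim.lean`; the block chain and notation:
`ABV17SingPermFourBlock.lean`).  `a` is a `4 × 4` matrix over a domain `L ⊇ K` with pivot
`g = a₀₀a₁₁ + a₀₁a₁₀ ≠ 0` whose four pivot minors vanish (`hP`); `BR = {2,3} × {2,3}` is freed first
(`block_chain`).  Notation (comments only): `U_{cj} = a₀c a₁ⱼ + a₀ⱼ a₁c`, `U'_{ri} = a_{r0} a_{i1} +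
a_{i0} a_{r1}`, `D = a₀₀a₀₁a₁₂a₁₃ + a₀₂a₀₃a₁₀a₁₁`, `D' = a₀₀a₁₀a₂₁a₃₁ + a₂₀a₃₀a₀₁a₁₁`,
`E_i = a_{i0} D + a_{i1} U₀₂U₀₃`, `E'_j = a_{0j} D' + a_{1j} U'₀₂U'₀₃`, `R1 = D² − U₀₂U₀₃U₁₂U₁₃`.

* `seven_le_of_D_ne_zero` — if `D ≠ 0`: after `BR`, the quartics `E₂, E₃` (elements of the ideal of
  `3 × 3` subpermanents, linear in `x₂₀`, `x₃₀` with coefficient `D`) free `x₂₀, x₃₀`, and the octic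
  `R1 ∈ K[x_{TL ∪ TR}]`, nonzero and vanishing at `a`, lies in the last kernel: height `≥ 7`;
* `seven_le_of_col_two_top_zero` / `seven_le_of_col_three_top_zero` — if the top of a right column
  vanishes: after `BR` its two coordinates are freed as zeros and `E'` of the other right column is a
  nonzero element of the last kernel: height `≥ 7`.
The value facts `E_i(a) = 0`, `R1(a) = 0`, `E'_j(a) = 0` are hypotheses here, derived from the
vanishing of the `3 × 3` subpermanents in the assembly file.

Honest framing: dictionary work (von zur Gathen's problem at `k = 4`); VP ≠ VNP is NOT proved.

## References
* J. Alper, T. Bogart, M. Velasco, Found. Comput. Math. 17 (2017), arXiv:1505.02205, §1 p0003 L38.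
  [AlperBogartVelasco2017]
* J. von zur Gathen, Linear Algebra Appl. 96 (1987) 87–100, proof of Lemma 2.3. [Vonzurgathen1987]
-/

noncomputable section

open Matrix MvPolynomial Finset

namespace Literature.Computability.AlgebraicComplexity

open VonZurGathen BoraleviCarliniMichalekVentura2025

namespace AlperBogartVelasco

variable {K : Type*} [Field K] {L : Type*} [CommRing L] [Algebra K L]

section Chains

variable (a : Fin 4 × Fin 4 → L) [IsDomain L]

/-! ### Case `D ≠ 0`: free `x₂₀, x₃₀` by `E₂, E₃`, then `R1 ≠ 0` -/

/-- **Case `D ≠ 0`**: with `E₂(a) = E₃(a) = 0` and `R1(a) = 0` (consequences of `hvan` and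
`BL ≠ 0`, third file), the chain `BR`, `x₂₀` (witness `E₂`, leading coefficient `D`), `x₃₀`
(witness `E₃`), and the nonzero polynomial `R1 ∈ K[x_{TL ∪ TR}]` in the last kernel give height
`≥ 7`. [cite: AlperBogartVelasco2017, §1 (sentence introducing Cor. 1.4), arXiv text p0003 L38] -/
theorem seven_le_of_D_ne_zero
    (hg : a (0, 0) * a (1, 1) + a (0, 1) * a (1, 0) ≠ 0)
    (hP : ∀ i j : Fin 4, i ≠ 0 → i ≠ 1 → j ≠ 0 → j ≠ 1 →
      a (i, j) * (a (0, 0) * a (1, 1) + a (0, 1) * a (1, 0)) +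
        a (i, 0) * (a (0, j) * a (1, 1) + a (0, 1) * a (1, j)) +
        a (i, 1) * (a (0, j) * a (1, 0) + a (0, 0) * a (1, j)) = 0)
    (hD : a (0, 0) * a (0, 1) * a (1, 2) * a (1, 3) + a (0, 2) * a (0, 3) * a (1, 0) * a (1, 1) ≠ 0)
    (hE : ∀ i : Fin 4, i ≠ 0 → i ≠ 1 →
      a (i, 0) * (a (0, 0) * a (0, 1) * a (1, 2) * a (1, 3) + a (0, 2) * a (0, 3) * a (1, 0) * a (1, 1)) +
        a (i, 1) * ((a (0, 0) * a (1, 2) + a (0, 2) * a (1, 0)) *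
          (a (0, 0) * a (1, 3) + a (0, 3) * a (1, 0))) = 0)
    (hR1 : (a (0, 0) * a (0, 1) * a (1, 2) * a (1, 3) + a (0, 2) * a (0, 3) * a (1, 0) * a (1, 1)) *
        (a (0, 0) * a (0, 1) * a (1, 2) * a (1, 3) + a (0, 2) * a (0, 3) * a (1, 0) * a (1, 1)) -
      (a (0, 0) * a (1, 2) + a (0, 2) * a (1, 0)) * (a (0, 0) * a (1, 3) + a (0, 3) * a (1, 0)) *
        ((a (0, 1) * a (1, 2) + a (0, 2) * a (1, 1)) * (a (0, 1) * a (1, 3) + a (0, 3) * a (1, 1))) = 0) :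
    (7 : ℕ∞) ≤ (RingHom.ker (aeval (R := K) a)).height := by
  have hblock := block_chain (K := K) a hg hP
  set pt : Finset (Fin 4 × Fin 4) → Fin 4 × Fin 4 → MvPolynomial (Fin 4 × Fin 4) L :=
    fun T => T.piecewise X (C ∘ a) with hpt
  -- the witness polynomials
  set Dp : MvPolynomial (Fin 4 × Fin 4) K :=
    X (0, 0) * X (0, 1) * X (1, 2) * X (1, 3) + X (0, 2) * X (0, 3) * X (1, 0) * X (1, 1) with hDp
  set Up : MvPolynomial (Fin 4 × Fin 4) K :=
    (X (0, 0) * X (1, 2) + X (0, 2) * X (1, 0)) * (X (0, 0) * X (1, 3) + X (0, 3) * X (1, 0)) with hUp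
  set E : Fin 4 → MvPolynomial (Fin 4 × Fin 4) K := fun i => X (i, 0) * Dp + X (i, 1) * Up with hEdef
  set R1 : MvPolynomial (Fin 4 × Fin 4) K := Dp * Dp -
    Up * ((X (0, 1) * X (1, 2) + X (0, 2) * X (1, 1)) * (X (0, 1) * X (1, 3) + X (0, 3) * X (1, 1)))
    with hR1def
  set T₄ : Finset (Fin 4 × Fin 4) := {(2, 2), (2, 3), (3, 2), (3, 3)} with hT₄
  set T₅ : Finset (Fin 4 × Fin 4) := insert (2, 0) T₄ with hT₅
  set T₆ : Finset (Fin 4 × Fin 4) := insert (3, 0) T₅ with hT₆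
  -- step 5: free `x₂₀`
  have s₅ : (RingHom.ker (aeval (R := K) (pt T₅))).height + 1 ≤
      (RingHom.ker (aeval (R := K) (pt T₄))).height := by
    refine height_ker_aeval_piecewise_insert a T₄ (2, 0) (E 2) ?_ ?_
    · have h : aeval (pt T₄) (E 2) = C (a (2, 0) * (a (0, 0) * a (0, 1) * a (1, 2) * a (1, 3) +
          a (0, 2) * a (0, 3) * a (1, 0) * a (1, 1)) + a (2, 1) * ((a (0, 0) * a (1, 2) +
          a (0, 2) * a (1, 0)) * (a (0, 0) * a (1, 3) + a (0, 3) * a (1, 0)))) := by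
        simp (disch := decide) only [hEdef, hDp, hUp, hpt, hT₄, map_add, map_mul,
          aeval_piecewise_X_of_notMem]
      rw [h, hE 2 (by decide) (by decide), map_zero]
    · have h : aeval (pt T₅) (E 2) = X (2, 0) * C (a (0, 0) * a (0, 1) * a (1, 2) * a (1, 3) +
          a (0, 2) * a (0, 3) * a (1, 0) * a (1, 1)) + C (a (2, 1) * ((a (0, 0) * a (1, 2) +
          a (0, 2) * a (1, 0)) * (a (0, 0) * a (1, 3) + a (0, 3) * a (1, 0)))) := by
        simp (disch := decide) only [hEdef, hDp, hUp, hpt, hT₅, hT₄, map_add, map_mul,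
          aeval_piecewise_X_of_notMem, aeval_piecewise_X_of_mem]
      rw [h]
      exact X_mul_C_add_C_ne_zero hD
  -- step 6: free `x₃₀`
  have s₆ : (RingHom.ker (aeval (R := K) (pt T₆))).height + 1 ≤
      (RingHom.ker (aeval (R := K) (pt T₅))).height := by
    refine height_ker_aeval_piecewise_insert a T₅ (3, 0) (E 3) ?_ ?_
    · have h : aeval (pt T₅) (E 3) = C (a (3, 0) * (a (0, 0) * a (0, 1) * a (1, 2) * a (1, 3) +
          a (0, 2) * a (0, 3) * a (1, 0) * a (1, 1)) + a (3, 1) * ((a (0, 0) * a (1, 2) +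
          a (0, 2) * a (1, 0)) * (a (0, 0) * a (1, 3) + a (0, 3) * a (1, 0)))) := by
        simp (disch := decide) only [hEdef, hDp, hUp, hpt, hT₅, hT₄, map_add, map_mul,
          aeval_piecewise_X_of_notMem]
      rw [h, hE 3 (by decide) (by decide), map_zero]
    · have h : aeval (pt T₆) (E 3) = X (3, 0) * C (a (0, 0) * a (0, 1) * a (1, 2) * a (1, 3) +
          a (0, 2) * a (0, 3) * a (1, 0) * a (1, 1)) + C (a (3, 1) * ((a (0, 0) * a (1, 2) +
          a (0, 2) * a (1, 0)) * (a (0, 0) * a (1, 3) + a (0, 3) * a (1, 0)))) := by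
        simp (disch := decide) only [hEdef, hDp, hUp, hpt, hT₆, hT₅, hT₄, map_add, map_mul,
          aeval_piecewise_X_of_notMem, aeval_piecewise_X_of_mem]
      rw [h]
      exact X_mul_C_add_C_ne_zero hD
  -- step 7: `R1` is a nonzero element of the last kernel
  have hR1ne : R1 ≠ 0 := by
    intro h0
    have h := congrArg (MvPolynomial.eval (fun x : Fin 4 × Fin 4 =>
      if x ∈ ({(0, 0), (1, 1), (0, 2), (0, 3), (1, 2), (1, 3)} : Finset (Fin 4 × Fin 4))
      then (1 : K) else 0)) h0
    simp [hR1def, hDp, hUp] at h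
  have s₇ : (1 : ℕ∞) ≤ (RingHom.ker (aeval (R := K) (pt T₆))).height := by
    refine one_le_height_ker _ R1 hR1ne ?_
    have h : aeval (pt T₆) R1 = C ((a (0, 0) * a (0, 1) * a (1, 2) * a (1, 3) +
          a (0, 2) * a (0, 3) * a (1, 0) * a (1, 1)) *
        (a (0, 0) * a (0, 1) * a (1, 2) * a (1, 3) + a (0, 2) * a (0, 3) * a (1, 0) * a (1, 1)) -
      (a (0, 0) * a (1, 2) + a (0, 2) * a (1, 0)) * (a (0, 0) * a (1, 3) + a (0, 3) * a (1, 0)) *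
        ((a (0, 1) * a (1, 2) + a (0, 2) * a (1, 1)) * (a (0, 1) * a (1, 3) + a (0, 3) * a (1, 1)))) := by
      simp (disch := decide) only [hR1def, hDp, hUp, hpt, hT₆, hT₅, hT₄, map_sub, map_add, map_mul,
        aeval_piecewise_X_of_notMem]
    rw [h, hR1, map_zero]
  have e4 : pt T₄ = (({(2, 2), (2, 3), (3, 2), (3, 3)} : Finset (Fin 4 × Fin 4)).piecewise X
      (C ∘ a) : Fin 4 × Fin 4 → MvPolynomial (Fin 4 × Fin 4) L) := rfl
  calc (7 : ℕ∞) = 1 + 1 + 1 + 4 := by norm_num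
    _ ≤ (RingHom.ker (aeval (R := K) (pt T₆))).height + 1 + 1 + 4 := by gcongr
    _ ≤ (RingHom.ker (aeval (R := K) (pt T₅))).height + 1 + 4 := by gcongr
    _ ≤ (RingHom.ker (aeval (R := K) (pt T₄))).height + 4 := by gcongr
    _ ≤ _ := by rw [e4]; exact hblock

/-! ### Case: the top of a right column vanishes -/

/-- **Case `a₀₂ = a₁₂ = 0`** (top of column `2` vanishes): with `E'₃(a) = 0` (third file), the
chain `BR`, the two zeros `x₀₂, x₁₂`, and the nonzero polynomial `E'₃ = x₀₃ D' + x₁₃ U'₀₂U'₀₃` in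
the last kernel give height `≥ 7`. [cite: AlperBogartVelasco2017, §1 (sentence introducing Cor. 1.4), arXiv text p0003 L38] -/
theorem seven_le_of_col_two_top_zero
    (hg : a (0, 0) * a (1, 1) + a (0, 1) * a (1, 0) ≠ 0)
    (hP : ∀ i j : Fin 4, i ≠ 0 → i ≠ 1 → j ≠ 0 → j ≠ 1 →
      a (i, j) * (a (0, 0) * a (1, 1) + a (0, 1) * a (1, 0)) +
        a (i, 0) * (a (0, j) * a (1, 1) + a (0, 1) * a (1, j)) +
        a (i, 1) * (a (0, j) * a (1, 0) + a (0, 0) * a (1, j)) = 0)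
    (h02 : a (0, 2) = 0) (h12 : a (1, 2) = 0)
    (hE' : a (0, 3) * (a (0, 0) * a (1, 0) * a (2, 1) * a (3, 1) + a (2, 0) * a (3, 0) * a (0, 1) * a (1, 1)) +
      a (1, 3) * ((a (0, 0) * a (2, 1) + a (2, 0) * a (0, 1)) * (a (0, 0) * a (3, 1) + a (3, 0) * a (0, 1))) = 0) :
    (7 : ℕ∞) ≤ (RingHom.ker (aeval (R := K) a)).height := by
  have hblock := block_chain (K := K) a hg hP
  set pt : Finset (Fin 4 × Fin 4) → Fin 4 × Fin 4 → MvPolynomial (Fin 4 × Fin 4) L :=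
    fun T => T.piecewise X (C ∘ a) with hpt
  set T₄ : Finset (Fin 4 × Fin 4) := {(2, 2), (2, 3), (3, 2), (3, 3)} with hT₄
  set S : Finset (Fin 4 × Fin 4) := {(0, 2), (1, 2)} with hSdef
  have hS : ∀ x ∈ S, a x = 0 := by
    intro x hx
    simp only [hSdef, Finset.mem_insert, Finset.mem_singleton] at hx
    rcases hx with rfl | rfl
    · exact h02
    · exact h12
  have hdisj : Disjoint S T₄ := by rw [hSdef, hT₄]; decide
  have h56 := height_ker_aeval_piecewise_union_add_card_le (K := K) a T₄ S hS hdisj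
  have hScard : S.card = 2 := by rw [hSdef]; decide
  rw [hScard] at h56
  push_cast at h56
  -- the nonzero element `E'₃` of the last kernel
  set W : MvPolynomial (Fin 4 × Fin 4) K := X (0, 3) * (X (0, 0) * X (1, 0) * X (2, 1) * X (3, 1) +
      X (2, 0) * X (3, 0) * X (0, 1) * X (1, 1)) +
    X (1, 3) * ((X (0, 0) * X (2, 1) + X (2, 0) * X (0, 1)) * (X (0, 0) * X (3, 1) + X (3, 0) * X (0, 1)))
    with hW
  have hWne : W ≠ 0 := by
    intro h0
    have h := congrArg (MvPolynomial.eval (fun x : Fin 4 × Fin 4 =>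
      if x ∈ ({(0, 3), (0, 0), (1, 0), (2, 1), (3, 1)} : Finset (Fin 4 × Fin 4)) then (1 : K) else 0)) h0
    simp [hW] at h
  have s₇ : (1 : ℕ∞) ≤ (RingHom.ker (aeval (R := K) (pt (T₄ ∪ S)))).height := by
    refine one_le_height_ker _ W hWne ?_
    have h : aeval (pt (T₄ ∪ S)) W = C (a (0, 3) * (a (0, 0) * a (1, 0) * a (2, 1) * a (3, 1) +
        a (2, 0) * a (3, 0) * a (0, 1) * a (1, 1)) +
      a (1, 3) * ((a (0, 0) * a (2, 1) + a (2, 0) * a (0, 1)) * (a (0, 0) * a (3, 1) + a (3, 0) * a (0, 1)))) := by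
      simp (disch := decide) only [hW, hpt, hT₄, hSdef, map_add, map_mul, aeval_piecewise_X_of_notMem]
    rw [h, hE', map_zero]
  have e4 : pt T₄ = (({(2, 2), (2, 3), (3, 2), (3, 3)} : Finset (Fin 4 × Fin 4)).piecewise X
      (C ∘ a) : Fin 4 × Fin 4 → MvPolynomial (Fin 4 × Fin 4) L) := rfl
  calc (7 : ℕ∞) = 1 + 2 + 4 := by norm_num
    _ ≤ (RingHom.ker (aeval (R := K) (pt (T₄ ∪ S)))).height + 2 + 4 := by gcongr
    _ ≤ (RingHom.ker (aeval (R := K) (pt T₄))).height + 4 := by gcongr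
    _ ≤ _ := by rw [e4]; exact hblock

/-- **Case `a₀₃ = a₁₃ = 0`** (top of column `3` vanishes): symmetric to
`seven_le_of_col_two_top_zero`, with the nonzero element `E'₂ = x₀₂ D' + x₁₂ U'₀₂U'₀₃`.
[cite: AlperBogartVelasco2017, §1 (sentence introducing Cor. 1.4), arXiv text p0003 L38] -/
theorem seven_le_of_col_three_top_zero
    (hg : a (0, 0) * a (1, 1) + a (0, 1) * a (1, 0) ≠ 0)
    (hP : ∀ i j : Fin 4, i ≠ 0 → i ≠ 1 → j ≠ 0 → j ≠ 1 →
      a (i, j) * (a (0, 0) * a (1, 1) + a (0, 1) * a (1, 0)) +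
        a (i, 0) * (a (0, j) * a (1, 1) + a (0, 1) * a (1, j)) +
        a (i, 1) * (a (0, j) * a (1, 0) + a (0, 0) * a (1, j)) = 0)
    (h03 : a (0, 3) = 0) (h13 : a (1, 3) = 0)
    (hE' : a (0, 2) * (a (0, 0) * a (1, 0) * a (2, 1) * a (3, 1) + a (2, 0) * a (3, 0) * a (0, 1) * a (1, 1)) +
      a (1, 2) * ((a (0, 0) * a (2, 1) + a (2, 0) * a (0, 1)) * (a (0, 0) * a (3, 1) + a (3, 0) * a (0, 1))) = 0) :
    (7 : ℕ∞) ≤ (RingHom.ker (aeval (R := K) a)).height := by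
  have hblock := block_chain (K := K) a hg hP
  set pt : Finset (Fin 4 × Fin 4) → Fin 4 × Fin 4 → MvPolynomial (Fin 4 × Fin 4) L :=
    fun T => T.piecewise X (C ∘ a) with hpt
  set T₄ : Finset (Fin 4 × Fin 4) := {(2, 2), (2, 3), (3, 2), (3, 3)} with hT₄
  set S : Finset (Fin 4 × Fin 4) := {(0, 3), (1, 3)} with hSdef
  have hS : ∀ x ∈ S, a x = 0 := by
    intro x hx
    simp only [hSdef, Finset.mem_insert, Finset.mem_singleton] at hx
    rcases hx with rfl | rfl
    · exact h03
    · exact h13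
  have hdisj : Disjoint S T₄ := by rw [hSdef, hT₄]; decide
  have h56 := height_ker_aeval_piecewise_union_add_card_le (K := K) a T₄ S hS hdisj
  have hScard : S.card = 2 := by rw [hSdef]; decide
  rw [hScard] at h56
  push_cast at h56
  set W : MvPolynomial (Fin 4 × Fin 4) K := X (0, 2) * (X (0, 0) * X (1, 0) * X (2, 1) * X (3, 1) +
      X (2, 0) * X (3, 0) * X (0, 1) * X (1, 1)) +
    X (1, 2) * ((X (0, 0) * X (2, 1) + X (2, 0) * X (0, 1)) * (X (0, 0) * X (3, 1) + X (3, 0) * X (0, 1)))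
    with hW
  have hWne : W ≠ 0 := by
    intro h0
    have h := congrArg (MvPolynomial.eval (fun x : Fin 4 × Fin 4 =>
      if x ∈ ({(0, 2), (0, 0), (1, 0), (2, 1), (3, 1)} : Finset (Fin 4 × Fin 4)) then (1 : K) else 0)) h0
    simp [hW] at h
  have s₇ : (1 : ℕ∞) ≤ (RingHom.ker (aeval (R := K) (pt (T₄ ∪ S)))).height := by
    refine one_le_height_ker _ W hWne ?_
    have h : aeval (pt (T₄ ∪ S)) W = C (a (0, 2) * (a (0, 0) * a (1, 0) * a (2, 1) * a (3, 1) +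
        a (2, 0) * a (3, 0) * a (0, 1) * a (1, 1)) +
      a (1, 2) * ((a (0, 0) * a (2, 1) + a (2, 0) * a (0, 1)) * (a (0, 0) * a (3, 1) + a (3, 0) * a (0, 1)))) := by
      simp (disch := decide) only [hW, hpt, hT₄, hSdef, map_add, map_mul, aeval_piecewise_X_of_notMem]
    rw [h, hE', map_zero]
  have e4 : pt T₄ = (({(2, 2), (2, 3), (3, 2), (3, 3)} : Finset (Fin 4 × Fin 4)).piecewise X
      (C ∘ a) : Fin 4 × Fin 4 → MvPolynomial (Fin 4 × Fin 4) L) := rfl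
  calc (7 : ℕ∞) = 1 + 2 + 4 := by norm_num
    _ ≤ (RingHom.ker (aeval (R := K) (pt (T₄ ∪ S)))).height + 2 + 4 := by gcongr
    _ ≤ (RingHom.ker (aeval (R := K) (pt T₄))).height + 4 := by gcongr
    _ ≤ _ := by rw [e4]; exact hblock

end Chains

end AlperBogartVelasco

end Literature.Computability.AlgebraicComplexity

end
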